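import Summits.Ventures.PercRepro.C041TriDomTwoClasses
import Summits.Ventures.PercRepro.C041TriDomGluePendant

/-!
# ROW C-041 — THEOREM (LEAF MARK): CONJECTURE (STOCHASTIC DOMINATION) HOLDS WHENEVER A MARK HAS AT MOST ONE PRESENT
EDGE (p6, gen 50; P6-TWOEXIT-LEAN.md §53 ADDENDUM 24)

A mark with at most one present edge `f` (`LeafS`: every other edge at the mark is absent, and `f` is not double)
cannot be red-connected to one mark and blue-connected to another: a red path leaving the mark starts with a red
edge at the mark — only `f`, red — and a blue path with a blue one — only `f`, blue (`rdS_first_edge`,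
`mgS_first_edge`, `not_C12S_of_leafS`).  So the cyclic crossed class sharing that mark is EMPTY, and COROLLARY
(TWO CLASSES) (`pair23_31_le_topBotS`) dominates the two remaining classes by `(⊤, ⊥)` on every up-set
(`cycDominationS_of_leafS`; at the exits by the rotation `cycDominationS_rot`: `cycDominationS_of_leafS_exit`,
`cycDominationS_of_leafS_exit'`; the all-free host with a host-level leaf: `cycDomination_of_leaf`,
`cycDomination_of_leaf_exit`, `cycDomination_of_leaf_exit'`).

CONSEQUENCES.  (i) The SIBLING DOMINATION of `(x, y; v)` holds on every all-free host carrying a leaf `z` at `v`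
(`sibDominationS_of_pendant`, through `sib_of_cycDomination_pendant` of `C041TriDomGluePendant`) — the sibling is
the conjecture with a pendant edge, and the conjecture with a pendant edge is a theorem.  (ii) The first base case of
the rebalancing hierarchy of ADDENDUM 23 (the statement `payerAC` on the hosts whose anchor has no free edge left
after the split edge `f = xq`, i.e. the three-mark statement `#(⊤,⊥) + #(⊤,s_qz) ≥ #(s_yz,s_qy) + #(s_qz,s_yz) +
#(s_qz,⊤)` on `(q, y, z)`) is CONJECTURE (STOCHASTIC DOMINATION) for the pendant anchor `x` on the product up-sets
`V × {f red, f blue}` — a theorem by `cycDominationS_of_leafS` (paper: ADDENDUM 24).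
-/

namespace PercRepro

namespace ZoneZ

namespace MultiExit

open ZoneData Finset

variable {V₁ E₁ U₁ U₂ : Type} (Z₁ : ZoneData V₁ E₁ U₁ U₂) (st : E₁ → EStat) (x y z : V₁)

/-! ## A mark with at most one present edge -/

/-- `x` has at most one present edge, `f`, and `f` is not double: every other edge at `x` is absent. -/
def LeafS (f : E₁) : Prop :=
  st f ≠ EStat.double ∧ ∀ e, (Z₁.fst e = x ∨ Z₁.snd e = x) → e ≠ f → st e = EStat.absent

/-- An edge joining `x` to something touches `x`. -/
theorem touches_of_joins {e : E₁} {w : V₁} (h : Z₁.Joins e x w) : Z₁.fst e = x ∨ Z₁.snd e = x := by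
  unfold ZoneData.Joins at h
  rcases h with ⟨h1, _⟩ | ⟨_, h2⟩
  · exact Or.inl h1
  · exact Or.inr h2

/-- A red path from `x` to another vertex starts with a red edge at `x`. -/
theorem rdS_first_edge (ω : E₁ → Bool) {v : V₁} (hv : v ≠ x) (h : RdS Z₁ st ω x v) :
    ∃ e, (Z₁.fst e = x ∨ Z₁.snd e = x) ∧ redE st ω e := by
  unfold RdS at h
  rw [mem_reach_singleton] at h
  rcases Relation.ReflTransGen.cases_head h with h | ⟨w, ⟨e, he, hr⟩, _⟩
  · exact absurd h.symm hv
  · exact ⟨e, touches_of_joins Z₁ x he, hr⟩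

/-- A blue path from `x` to another vertex starts with a blue edge at `x`. -/
theorem mgS_first_edge (ω : E₁ → Bool) {v : V₁} (hv : v ≠ x) (h : MgS Z₁ st ω x v) :
    ∃ e, (Z₁.fst e = x ∨ Z₁.snd e = x) ∧ blueE st ω e := by
  unfold MgS at h
  rw [mem_reach_singleton] at h
  rcases Relation.ReflTransGen.cases_head h with h | ⟨w, ⟨e, he, hb⟩, _⟩
  · exact absurd h.symm hv
  · exact ⟨e, touches_of_joins Z₁ x he, hb⟩

/-- Under `LeafS`, a red edge at `x` is `f`, red. -/
theorem leafS_red {f : E₁} (hl : LeafS Z₁ st x f) (ω : E₁ → Bool) {e : E₁}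
    (he : Z₁.fst e = x ∨ Z₁.snd e = x) (hr : redE st ω e) : ω f = true := by
  by_cases hef : e = f
  · subst hef
    rcases hr with hr | ⟨_, hr⟩
    · exact absurd hr hl.1
    · exact hr
  · have := hl.2 e he hef
    rcases hr with hr | ⟨hr, _⟩ <;> simp [this] at hr

/-- Under `LeafS`, a blue edge at `x` is `f`, blue. -/
theorem leafS_blue {f : E₁} (hl : LeafS Z₁ st x f) (ω : E₁ → Bool) {e : E₁}
    (he : Z₁.fst e = x ∨ Z₁.snd e = x) (hb : blueE st ω e) : ω f = false := by
  by_cases hef : e = f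
  · subst hef
    rcases hb with hb | ⟨_, hb⟩
    · exact absurd hb hl.1
    · exact hb
  · have := hl.2 e he hef
    rcases hb with hb | ⟨hb, _⟩ <;> simp [this] at hb

/-- **A leaf mark is never the shared mark of a crossed colouring**: the class `(s₁,s₂)` of `(x, y, z)` (red `x ~ y`,
blue `x ~ z`) is empty when `x` has at most one present edge. -/
theorem not_C12S_of_leafS {f : E₁} (hl : LeafS Z₁ st x f) (ω : E₁ → Bool) : ¬ C12S Z₁ st x y z ω := by
  rintro ⟨⟨hxy, hxz, _⟩, ⟨hmxy, hmxz, _⟩⟩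
  have hy : y ≠ x := fun h => hmxy (h ▸ MgS_refl' Z₁ st ω x)
  have hz : z ≠ x := fun h => hxz (h ▸ RdS_refl' Z₁ st ω x)
  obtain ⟨e, he, hr⟩ := rdS_first_edge Z₁ st x ω hy hxy
  obtain ⟨e', he', hb⟩ := mgS_first_edge Z₁ st x ω hz hmxz
  have h1 := leafS_red Z₁ st x hl ω he hr
  have h2 := leafS_blue Z₁ st x hl ω he' hb
  rw [h1] at h2
  exact Bool.noConfusion h2

section Counting

variable [Fintype E₁] [DecidableEq E₁]

open Classical in
/-- **THEOREM (LEAF MARK, anchor)**: if the anchor `x` has at most one present edge, CONJECTURE (STOCHASTIC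
DOMINATION) holds on every up-set of the status. -/
theorem cycDominationS_of_leafS {f : E₁} (hl : LeafS Z₁ st x f) : CycDominationS Z₁ x y z st := by
  intro V hV
  refine le_of_eq_of_le (card_filter_congr' fun ω _ => and_congr_right fun _ => ?_)
    (pair23_31_le_topBotS Z₁ st x y z hV)
  rw [cycCrossedS_iff_classes]
  constructor
  · rintro (h | h | h)
    · exact absurd h (not_C12S_of_leafS Z₁ st x y z hl ω)
    · exact Or.inl h
    · exact Or.inr h
  · rintro (h | h)
    · exact Or.inr (Or.inl h)
    · exact Or.inr (Or.inr h)

open Classical in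
/-- **THEOREM (LEAF MARK, first exit)**: if the exit `y` has at most one present edge, the conjecture holds. -/
theorem cycDominationS_of_leafS_exit {f : E₁} (hl : LeafS Z₁ st y f) : CycDominationS Z₁ x y z st :=
  (cycDominationS_rot Z₁ st x y z).mpr (cycDominationS_of_leafS Z₁ st y z x hl)

open Classical in
/-- **THEOREM (LEAF MARK, second exit)**: if the exit `z` has at most one present edge, the conjecture holds. -/
theorem cycDominationS_of_leafS_exit' {f : E₁} (hl : LeafS Z₁ st z f) : CycDominationS Z₁ x y z st :=
  (cycDominationS_rot Z₁ st x y z).mpr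
    ((cycDominationS_rot Z₁ st y z x).mpr (cycDominationS_of_leafS Z₁ st z x y hl))

omit [Fintype E₁] [DecidableEq E₁] in
/-- A host-level leaf (every edge at `x` is `f`) is a `LeafS` of the all-free status. -/
theorem leafS_free_of_leaf {f : E₁} (hf : ∀ e, (Z₁.fst e = x ∨ Z₁.snd e = x) → e = f) :
    LeafS Z₁ (fun _ => EStat.free) x f :=
  ⟨fun h => EStat.noConfusion h, fun e he hef => absurd (hf e he) hef⟩

/-- **THEOREM (LEAF MARK) on the all-free host**: a mark `x` with at most one edge. -/
theorem cycDomination_of_leaf {f : E₁} (hf : ∀ e, (Z₁.fst e = x ∨ Z₁.snd e = x) → e = f) :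
    CycDomination Z₁ x y z :=
  (cycDominationS_free Z₁ x y z).mp (cycDominationS_of_leafS Z₁ _ x y z (leafS_free_of_leaf Z₁ x hf))

/-- The all-free host with the first exit `y` a leaf. -/
theorem cycDomination_of_leaf_exit {f : E₁} (hf : ∀ e, (Z₁.fst e = y ∨ Z₁.snd e = y) → e = f) :
    CycDomination Z₁ x y z :=
  (cycDominationS_free Z₁ x y z).mp (cycDominationS_of_leafS_exit Z₁ _ x y z (leafS_free_of_leaf Z₁ y hf))

/-- The all-free host with the second exit `z` a leaf. -/
theorem cycDomination_of_leaf_exit' {f : E₁} (hf : ∀ e, (Z₁.fst e = z ∨ Z₁.snd e = z) → e = f) :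
    CycDomination Z₁ x y z :=
  (cycDominationS_free Z₁ x y z).mp (cycDominationS_of_leafS_exit' Z₁ _ x y z (leafS_free_of_leaf Z₁ z hf))

/-- **THE SIBLING DOMINATION HOLDS ON EVERY PENDANT HOST**: for a leaf `z` hanging at `v` by `f`, the sibling
domination of `(x, y; v)` with `f` deleted holds — it is the conjecture for `(x, y, z)` with `f` free
(`sib_of_cycDomination_pendant`), and that is THEOREM (LEAF MARK) at the exit `z`. -/
theorem sibDominationS_of_pendant (v : V₁) (f : E₁) (hz : z ≠ v) (hf : Pendant Z₁ z v f) (hx : x ≠ z)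
    (hy : y ≠ z) : SibDominationS Z₁ x y v (stOutS Z₁ (fun _ => EStat.free) v z) :=
  sib_of_cycDomination_pendant Z₁ x y z v f hz hf hx hy (cycDomination_of_leaf_exit' Z₁ x y z hf.2)

end Counting

end MultiExit

end ZoneZ

end PercRepro
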